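import Literature.NumberTheory.Irrationality.LaiYu2020.AnalysisLemmaLimit
import Literature.NumberTheory.Irrationality.LaiYu2020.ArithmeticLemmaRhoZero
import Literature.NumberTheory.Irrationality.FischlerSprangZudilin2019.EliminationProof
import HarnessLib

/-!
# Lai–Yu 2020, §5: the elimination step (Proposition 5.1, decay form)

Topic `Literature/NumberTheory/Irrationality/LaiYu2020`, namespace
`Literature.NumberTheory.Irrationality.LaiYu2020` (helpers in `Lemma41`). Source: L. Lai, P. Yu, *A note on the
number of irrational odd zeta values*, Compositio Math. 156 (2020) 1699–1717, arXiv:1911.08458, §5 ("Proof of the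
main theorem"), pp. 9–10 of the arXiv version [LaiYu2020]; the elimination technique is that of
[FischlerSprangZudilin2019, §6] (tree: `FischlerSprangZudilin2019.exists_int_weights`, `sum_hurwitzValue_eq`,
`TheoremTwo.card_divisors_le_card_irrational_of_decay`, which this file transports from the divisor set
`{d ∣ D}` of FSZ to the totient set `Ψ_B` of Lai–Yu).

Printed argument (§5): for `b ∈ Ψ_B` put `r̂_{n,b} = ∑_{k=1}^{b} r_{n,k/b}`; by (2.4)/(4.4) and the identity
`∑_{k=1}^{b} ζ(i, k/b) = b^i ζ(i)` (5.1), `r̂_{n,b} = ρ̂_{0,b} + ∑_{i odd} ρ_i b^i ζ(i)`. Choose integer weights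
`w_b` (`b ∈ Ψ_B`) with `∑_b w_b b^{i} = 0` for the `|Ψ_B| − 1` chosen odd exponents `i ∈ T ⊇ {irrational ζ(i)}`
and `∑_b w_b b ≠ 0` (generalised Vandermonde, [FSZ, Lemma 4]); then `r̃_n = ∑_b w_b r̂_{n,b}` is a linear form in
`1` and the RATIONAL `ζ(i)`, `i ∉ T`, so `A d_{n+1}^{s+1} r̃_n ∈ ℤ` (Lemma 3.3), while by Lemma 4.1
`r̃_n / r_{n,1} → ∑_b w_b b ≠ 0` and `d_{n+1}^{s+1} r_{n,1} → 0` (Prop. 4.2 (2): `g(x₀) < e^{−(s+1)}`): a non-zero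
integer of absolute value `< 1`, contradiction. Hence at least `|Ψ_B|` of `ζ(3), ζ(5), …, ζ(s)` are irrational
(Proposition 5.1: "if `|Ψ_B| − 1 ≤ #{odd i ≤ s}` and `g(x₀) < e^{−(s+1)}` then ...").

This file PROVES that statement with the two analytic inputs as hypotheses — the decay
`d_{vm+1}^{s+1} r_{vm,1} → 0` and the ratios `r_{vm,1}/r_{vm,θ} → 1` (`θ ∈ 𝓕_B`) — which the sibling files
discharge (`AnalysisLemmaRatio.tendsto_ratio`, `RootAsymptotics.eventually_Lam_le` with
`AnalysisLemmaLimit.rT_le_exp`): `card_denominatorSet_le_card_irrational_of_decay`. Conventions as in the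
sibling files: `r = u/v` with `v` even, `n = vm`.
WHAT THIS IS NOT: nothing here bears on `ζ(5)` (cell zeta5-irr, rung F-Z1).
-/

open Finset Filter
open scoped Topology

namespace Literature.NumberTheory.Irrationality.LaiYu2020

open Literature.NumberTheory.Transcendental (zetaValue)
open Literature.NumberTheory.Transcendental.OddZeta (dvd_lcmUpto)
open Literature.NumberTheory.Transcendental.BallRivoal (pfEval)
open Literature.NumberTheory.Irrationality.DirichletLValues (hurwitzValue)
open Literature.NumberTheory.Irrationality.FischlerSprangZudilin2019 (exists_int_weights sum_hurwitzValue_eq)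

namespace Lemma41

/-! ### Partial-fraction data in both indexings -/

/-- The partial-fraction data of `R_n` in both indexings used by the tree: `a_{i,k}` (eq. (2.3), for
Lemma 3.3's `ρ_i`) and `c_{o,p} = a_{o+1,p}` (the `pfEval` form, for Lemma 2.5 / Lemma 3.3's `ρ_{0,θ}`).
[cite: LaiYu2020, §2 eq. (2.3)] -/
theorem exists_pf_pair (u v s : ℕ) (B : ℝ) (m : ℕ)
    (hdeg : 1 + (2 * u + v) * m * (zeroSet_finite B).toFinset.card < (s + 1) * (v * m + 1)) :
    ∃ a c : ℕ → ℕ → ℚ,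
      (∀ t : ℚ, (∀ j ∈ range (v * m + 1), t + j ≠ 0) →
        R u v s B m t = ∑ k ∈ range (v * m + 1), ∑ i ∈ Icc 1 (s + 1), a i k / (t + k) ^ i) ∧
      (∀ t : ℚ, (∀ p : ℕ, p ≤ v * m → t + p + 1 ≠ 0) →
        pfEval (v * m) (s + 1) c t = R u v s B m (t + 1)) ∧
      ∀ o p, c o p = a (o + 1) p := by
  obtain ⟨a, ha⟩ := exists_partialFraction u v s B m hdeg
  refine ⟨a, fun o p => a (o + 1) p, ha, fun t ht => ?_, fun _ _ => rfl⟩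
  have ht' : ∀ j ∈ range (v * m + 1), t + 1 + (j : ℚ) ≠ 0 := by
    intro j hj h
    exact ht j (by have := mem_range.1 hj; omega) (by linarith)
  rw [ha (t + 1) ht', pfEval]
  refine sum_congr rfl fun p _ => ?_
  rw [show Icc 1 (s + 1) = Ico 1 (s + 1 + 1) from rfl, sum_Ico_eq_sum_range,
    show s + 1 + 1 - 1 = s + 1 by omega]
  refine sum_congr rfl fun o _ => ?_
  rw [add_comm 1 o]
  ring

/-! ### The coefficients `ρ_{0,θ}`, `ρ_i` of `r_{n,θ}` -/

/-- `ρ_{0,θ}` of (2.4)/(4.4) in the `pfEval` indexing (`n = vm`):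
`−∑_{k ≤ n} ∑_{ℓ ≤ k} ∑_{o ≤ s} c_{o,k}/(ℓ+θ)^{o+1}`. [cite: LaiYu2020, Lemma 2.5 (ρ_{0,θ})] -/
def rhoZeroLY (v s m : ℕ) (c : ℕ → ℕ → ℚ) (θ : ℚ) : ℚ :=
  -∑ k ∈ range (v * m + 1), ∑ ℓ ∈ range (k + 1), ∑ o ∈ range (s + 1), c o k / ((ℓ : ℚ) + θ) ^ (o + 1)

/-- `ρ_i = ∑_k a_{i,k} = ∑_k c_{i−1,k}` of (2.4)/(4.4). [cite: LaiYu2020, Lemma 2.5 (ρ_i = ∑_k a_{i,k})] -/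
def rhoLY (v m : ℕ) (c : ℕ → ℕ → ℚ) (i : ℕ) : ℚ := ∑ k ∈ range (v * m + 1), c (i - 1) k

/-- **`r_{n,θ} = ρ_{0,θ} + ∑_{3 ≤ i ≤ s, i odd} ρ_i ζ(i,θ)`** (`θ ∈ 𝓕_B`; eq. (4.4) = Lemma 2.5).
[cite: LaiYu2020, §4 eq. (4.4), Lemma 2.5] -/
theorem rT_eq_linearForm {u v s : ℕ} {B : ℝ} {m : ℕ} (hB : 1 ≤ B) (hs : Odd s) (hn : Even (v * m))
    (hum : 1 ≤ u * m)
    (hdeg : 1 + (2 * u + v) * m * (zeroSet_finite B).toFinset.card + 2 ≤ (s + 1) * (v * m + 1))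
    {c : ℕ → ℕ → ℚ}
    (hc : ∀ t : ℚ, (∀ p : ℕ, p ≤ v * m → t + p + 1 ≠ 0) →
      pfEval (v * m) (s + 1) c t = R u v s B m (t + 1))
    {θ : ℚ} (hθ : θ ∈ zeroSet B) :
    rT u v s B m θ = (rhoZeroLY v s m c θ : ℝ) +
      ∑ i ∈ (Finset.Icc 3 s).filter Odd, (rhoLY v m c i : ℝ) * hurwitzValue i (θ : ℝ) := by
  rw [rT, (hasSum_cT hB hs hn hum hdeg hc hθ).tsum_eq, rhoZeroLY]
  rfl

/-! ### Integrality (Lemma 3.3) in the form used here -/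

/-- **`d_{n+1}^{s+1} ρ_i ∈ ℤ`** (`3 ≤ i ≤ s`; Lemma 3.3 (1)). [cite: LaiYu2020, Lemma 3.3 (1)] -/
theorem lcm_pow_mul_rhoLY_isInt {u v s : ℕ} {B : ℝ} {m : ℕ} (hm : 1 ≤ m) (hv : 1 ≤ v)
    {a c : ℕ → ℕ → ℚ}
    (hPF : ∀ t : ℚ, (∀ j ∈ range (v * m + 1), t + j ≠ 0) →
      R u v s B m t = ∑ k ∈ range (v * m + 1), ∑ i ∈ Icc 1 (s + 1), a i k / (t + k) ^ i)
    (hca : ∀ o p, c o p = a (o + 1) p) {i : ℕ} (hi1 : 1 ≤ i) (his : i ≤ s) :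
    ∃ z : ℤ, (Nat.lcmUpto (v * m + 1) : ℚ) ^ (s + 1) * rhoLY v m c i = z := by
  have hD : ∀ j : ℕ, 1 ≤ j → j ≤ v * m → j ∣ Nat.lcmUpto (v * m + 1) :=
    fun j h1 h2 => dvd_lcmUpto h1 (by omega)
  obtain ⟨z, hz⟩ := lemma33_rho_isInt (by omega) (by omega) hD hPF (i := i) (mem_Icc.2 ⟨hi1, by omega⟩)
  refine ⟨(Nat.lcmUpto (v * m + 1) : ℤ) ^ i * z, ?_⟩
  have e : rhoLY v m c i = ∑ k ∈ range (v * m + 1), a i k := by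
    rw [rhoLY]
    refine sum_congr rfl fun k _ => ?_
    rw [hca, show i - 1 + 1 = i by omega]
  push_cast
  rw [← hz, e, ← mul_assoc, ← pow_add, show i + (s + 1 - i) = s + 1 by omega]

/-- **`d_{n+1}^{s+1} ρ_{0,θ} ∈ ℤ`** (`θ ∈ 𝓕_B`; Lemma 3.3 (2)). [cite: LaiYu2020, Lemma 3.3 (2)] -/
theorem lcm_pow_mul_rhoZeroLY_isInt {u v s : ℕ} {B : ℝ} {m : ℕ} (hm : 1 ≤ m) (hv : 1 ≤ v) (hum : 1 ≤ u * m)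
    {c : ℕ → ℕ → ℚ}
    (hc : ∀ t : ℚ, (∀ p : ℕ, p ≤ v * m → t + p + 1 ≠ 0) →
      pfEval (v * m) (s + 1) c t = R u v s B m (t + 1))
    {θ : ℚ} (hθ : θ ∈ zeroSet B) :
    ∃ z : ℤ, (Nat.lcmUpto (v * m + 1) : ℚ) ^ (s + 1) * rhoZeroLY v s m c θ = z := by
  have hdiv : ∀ j : ℕ, 1 ≤ j → j ≤ v * m + 1 → j ∣ Nat.lcmUpto (v * m + 1) :=
    fun j h1 h2 => dvd_lcmUpto h1 h2
  obtain ⟨z, hz⟩ := lemma33_rhoZero_isInt (by omega) (by omega) hum hdiv hc hθ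
  exact ⟨z, by rw [rhoZeroLY]; exact hz⟩

/-! ### The identity (5.1) along `k/b`, `1 ≤ k ≤ b` -/

/-- The sample points `k/b`, `k = j+1`, `0 ≤ j < b`, of `r̂_{n,b} = ∑_{k=1}^{b} r_{n,k/b}`.
[cite: LaiYu2020, §5 (r̂_{n,b} = ∑_{k=1}^{b} r_{n,k/b})] -/
def thetaLY (b j : ℕ) : ℚ := ((j + 1 : ℕ) : ℚ) / b

/-- `thetaLY b j = (j+1)/b` as a real number. [cite: LaiYu2020, §5 (r̂_{n,b})] -/
theorem cast_thetaLY (b j : ℕ) : ((thetaLY b j : ℚ) : ℝ) = ((j : ℝ) + 1) / b := by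
  rw [thetaLY]
  push_cast
  ring

/-- `(j+1)/b ∈ 𝓕_B` for `b ∈ Ψ_B`, `j < b`. [cite: LaiYu2020, Def. 2.1 (2)] -/
theorem thetaLY_mem {B : ℝ} {b j : ℕ} (hb : b ∈ denominatorSet B) (hj : j < b) : thetaLY b j ∈ zeroSet B :=
  div_mem_zeroSet hb (by omega) (by omega)

/-! ### Proposition 5.1 (decay form) -/

/-- **Lai–Yu 2020, §5 / Proposition 5.1, elimination step (PROVED, decay form)**: let `r = u/v` with `v`
even, `B ≥ 1`, `s` odd with `(2r+1)|𝓕_B| + 2/v ≤ s+1`. Suppose `d_{n+1}^{s+1} r_{n,1} → 0` along `n = vm`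
(this is "`g(x₀) < e^{−(s+1)}`" of Prop. 5.1 via Lemma 4.1) and `r_{n,1}/r_{n,θ} → 1` for every `θ ∈ 𝓕_B`
(Lemma 4.1). If `|Ψ_B| − 1 ≤ #{odd i ∈ [3,s]}`, then at least `|Ψ_B|` of `ζ(3), ζ(5), …, ζ(s)` are
irrational. The proof is the printed one: weights `w_b` killing `|Ψ_B| − 1` odd powers ([FSZ, Lemma 4] via
`exists_int_weights`), `r̂_{n,b} = ∑_{k=1}^{b} r_{n,k/b} = ρ̂_{0,b} + ∑_i ρ_i b^i ζ(i)` by (5.1)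
(`sum_hurwitzValue_eq`), integrality `A d_{n+1}^{s+1} r̃_n ∈ ℤ` (Lemma 3.3), and
`r̃_n/r_{n,1} → ∑_b w_b b ≠ 0`. [cite: LaiYu2020, §5 (Prop. 5.1 and the proof of Thm. 1.1)] -/
theorem card_denominatorSet_le_card_irrational_of_decay {u v s : ℕ} {B : ℝ} (hu : 1 ≤ u) (hv : 1 ≤ v)
    (hve : Even v) (hB : 1 ≤ B) (hs : Odd s) (hs3 : 3 ≤ s)
    (hNs : (2 * u + v) * (zeroSet_finite B).toFinset.card + 2 ≤ (s + 1) * v)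
    (hdecay : Tendsto (fun m : ℕ => (Nat.lcmUpto (v * m + 1) : ℝ) ^ (s + 1) * rT u v s B m 1) atTop (𝓝 0))
    (hratio : ∀ θ ∈ zeroSet B, Tendsto (fun m : ℕ => rT u v s B m 1 / rT u v s B m θ) atTop (𝓝 1))
    (hroom : (denominatorSet_finite B).toFinset.card ≤ ((Finset.Icc 3 s).filter Odd).card + 1) :
    (denominatorSet_finite B).toFinset.card ≤
      Set.ncard {i : ℕ | Odd i ∧ 3 ≤ i ∧ i ≤ s ∧ Irrational (zetaValue i)} := by
  classical
  set Ψ := (denominatorSet_finite B).toFinset with hΨ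
  have hΨmem : ∀ b ∈ Ψ, b ∈ denominatorSet B := fun b hb => (denominatorSet_finite B).mem_toFinset.1 hb
  have hΨpos : ∀ b ∈ Ψ, 1 ≤ b := fun b hb => (hΨmem b hb).1
  have h1Ψ : 1 ∈ Ψ := by
    rw [hΨ, Set.Finite.mem_toFinset, mem_denominatorSet]
    refine ⟨one_pos, ?_⟩
    rw [Nat.totient_one]
    push_cast
    exact hB
  -- arithmetic side conditions valid for every `m ≥ 1`
  have hNs' : (2 * u + v) * (zeroSet_finite B).toFinset.card ≤ (s + 1) * v := by omega
  have hdeg : ∀ m : ℕ, 1 ≤ m →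
      1 + (2 * u + v) * m * (zeroSet_finite B).toFinset.card + 2 ≤ (s + 1) * (v * m + 1) := by
    intro m hm
    have h1 : (2 * u + v) * m * (zeroSet_finite B).toFinset.card =
        m * ((2 * u + v) * (zeroSet_finite B).toFinset.card) := by ring
    have h2 : m * ((2 * u + v) * (zeroSet_finite B).toFinset.card) + m * 2 ≤ m * ((s + 1) * v) := by
      rw [← mul_add]; exact Nat.mul_le_mul_left m hNs
    have h3 : (s + 1) * (v * m + 1) = m * ((s + 1) * v) + (s + 1) := by ring
    rw [h1, h3]
    omega
  have heven : ∀ m : ℕ, Even (v * m) := fun m => hve.mul_right m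
  have hum : ∀ m : ℕ, 1 ≤ m → 1 ≤ u * m := fun m hm => by nlinarith
  -- the set of irrational odd zeta values as a finset
  set Sfin := (Icc 3 s).filter (fun i => Odd i ∧ Irrational (zetaValue i)) with hSfin
  have hset : {i : ℕ | Odd i ∧ 3 ≤ i ∧ i ≤ s ∧ Irrational (zetaValue i)} = ↑Sfin := by
    ext i
    simp only [Set.mem_setOf_eq, hSfin, coe_filter, mem_Icc]
    tauto
  rw [hset, Set.ncard_coe_finset]
  by_contra hlt
  push Not at hlt
  set OddIcc := (Icc 3 s).filter Odd with hOddIcc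
  have hSsub : Sfin ⊆ OddIcc := by
    intro i hi
    rw [hSfin, mem_filter] at hi
    exact mem_filter.2 ⟨hi.1, hi.2.1⟩
  have hδpos : 1 ≤ #Ψ := card_pos.2 ⟨1, h1Ψ⟩
  -- the exponents `T ⊇ {irrational indices}`, `#T = |Ψ_B| - 1`
  obtain ⟨T, hST, hTO, hTcard⟩ := exists_subsuperset_card_eq hSsub (by omega : #Sfin ≤ #Ψ - 1)
    (by omega : #Ψ - 1 ≤ #OddIcc)
  have hTmem : ∀ t ∈ T, 3 ≤ t ∧ t ≤ s ∧ Odd t := by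
    intro t ht
    have := mem_filter.1 (hTO ht)
    exact ⟨(mem_Icc.1 this.1).1, (mem_Icc.1 this.1).2, this.2⟩
  have h1T : 1 ∉ T := fun h => by have := (hTmem 1 h).1; omega
  have hJcard : #Ψ = #(insert 1 T) := by rw [card_insert_of_notMem h1T, hTcard]; omega
  have hJ1 : ∀ t ∈ insert 1 T, 1 ≤ t := fun t ht =>
    (mem_insert.1 ht).elim (fun h => h ▸ le_rfl) (fun h => le_trans (by norm_num) (hTmem t h).1)
  obtain ⟨w, hwN, hwT⟩ := exists_int_weights Ψ (insert 1 T) hJcard hΨpos (mem_insert_self 1 T) hJ1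
  set Nw : ℤ := ∑ b ∈ Ψ, w b * (b : ℤ) with hNw
  set V : ℕ → ℤ := fun i => ∑ b ∈ Ψ, w b * (b : ℤ) ^ i with hV
  have hVT : ∀ t ∈ T, V t = 0 := fun t ht =>
    hwT t (mem_insert_of_mem ht) (fun h => h1T (h ▸ ht))
  -- partial-fraction data for every `m ≥ 1`
  have hexists : ∀ m : ℕ, ∃ ac : (ℕ → ℕ → ℚ) × (ℕ → ℕ → ℚ), 1 ≤ m →
      (∀ t : ℚ, (∀ j ∈ range (v * m + 1), t + j ≠ 0) →
        R u v s B m t = ∑ k ∈ range (v * m + 1), ∑ i ∈ Icc 1 (s + 1), ac.1 i k / (t + k) ^ i) ∧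
      (∀ t : ℚ, (∀ p : ℕ, p ≤ v * m → t + p + 1 ≠ 0) →
        pfEval (v * m) (s + 1) ac.2 t = R u v s B m (t + 1)) ∧
      ∀ o p, ac.2 o p = ac.1 (o + 1) p := by
    intro m
    by_cases hm : 1 ≤ m
    · obtain ⟨a, c, ha, hc, hac⟩ := exists_pf_pair u v s B m (by have := hdeg m hm; omega)
      exact ⟨(a, c), fun _ => ⟨ha, hc, hac⟩⟩
    · exact ⟨(fun _ _ => 0, fun _ _ => 0), fun h => absurd h hm⟩
  choose ac hac using hexists
  -- rational values of the non-eliminated zeta values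
  have hrat : ∀ i : ℕ, ∃ q : ℚ, i ∈ OddIcc → i ∉ T → zetaValue i = q := by
    intro i
    by_cases h : i ∈ OddIcc ∧ i ∉ T
    · have hnS : i ∉ Sfin := fun hS => h.2 (hST hS)
      have hnirr : ¬ Irrational (zetaValue i) := by
        intro hirr
        apply hnS
        have h1 := mem_filter.1 h.1
        exact mem_filter.2 ⟨h1.1, h1.2, hirr⟩
      unfold Irrational at hnirr
      push Not at hnirr
      obtain ⟨q, hq⟩ := hnirr
      exact ⟨q, fun _ _ => hq.symm⟩
    · exact ⟨0, fun h1 h2 => absurd ⟨h1, h2⟩ h⟩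
  choose q hq using hrat
  set A : ℕ := ∏ i ∈ OddIcc \ T, (q i).den with hA
  have hApos : 0 < A := prod_pos fun i _ => (q i).den_pos
  -- the sample points `θ = (j+1)/b ∈ 𝓕_B`
  have hθmem : ∀ b ∈ Ψ, ∀ j ∈ range b, thetaLY b j ∈ zeroSet B := fun b hb j hj =>
    thetaLY_mem (hΨmem b hb) (mem_range.1 hj)
  -- the combined linear forms `r̃_m = ∑_b w_b ∑_{j<b} r_{vm,(j+1)/b}`
  set rtilde : ℕ → ℝ := fun m => ∑ b ∈ Ψ, (w b : ℝ) *
    ∑ j ∈ range b, rT u v s B m (thetaLY b j) with hrtilde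
  -- Step 1: the arithmetic structure of `rtilde m`
  have hstruct : ∀ m : ℕ, 1 ≤ m → rtilde m =
      (∑ b ∈ Ψ, (w b : ℝ) * ∑ j ∈ range b, (rhoZeroLY v s m (ac m).2 (thetaLY b j) : ℝ)) +
      ∑ i ∈ OddIcc \ T, (rhoLY v m (ac m).2 i : ℝ) * (V i : ℝ) * (q i : ℝ) := by
    intro m hm
    obtain ⟨-, hc, -⟩ := hac m hm
    have hr : ∀ b ∈ Ψ, ∑ j ∈ range b, rT u v s B m (thetaLY b j) =
        ∑ j ∈ range b, (rhoZeroLY v s m (ac m).2 (thetaLY b j) : ℝ) +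
        ∑ i ∈ OddIcc, (rhoLY v m (ac m).2 i : ℝ) * ((b : ℝ) ^ i * zetaValue i) := by
      intro b hb
      have hb1 := hΨpos b hb
      have hterm : ∀ j ∈ range b, rT u v s B m (thetaLY b j) =
          (rhoZeroLY v s m (ac m).2 (thetaLY b j) : ℝ) +
          ∑ i ∈ OddIcc, (rhoLY v m (ac m).2 i : ℝ) * hurwitzValue i (((j : ℝ) + 1) / b) := by
        intro j hj
        rw [rT_eq_linearForm hB hs (heven m) (hum m hm) (hdeg m hm) hc (hθmem b hb j hj), cast_thetaLY]
      rw [sum_congr rfl hterm, sum_add_distrib, sum_comm]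
      congr 1
      refine sum_congr rfl fun i hi => ?_
      have hi2 : 2 ≤ i := by have := (mem_Icc.1 (mem_filter.1 hi).1).1; omega
      rw [← mul_sum, sum_hurwitzValue_eq b hb1 i hi2]
    have h1 : rtilde m = ∑ b ∈ Ψ, (w b : ℝ) *
        (∑ j ∈ range b, (rhoZeroLY v s m (ac m).2 (thetaLY b j) : ℝ) +
          ∑ i ∈ OddIcc, (rhoLY v m (ac m).2 i : ℝ) * ((b : ℝ) ^ i * zetaValue i)) := by
      rw [hrtilde]
      exact sum_congr rfl fun b hb => by rw [hr b hb]
    rw [h1]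
    simp_rw [mul_add, sum_add_distrib]
    congr 1
    have h2 : ∑ b ∈ Ψ, (w b : ℝ) * ∑ i ∈ OddIcc, (rhoLY v m (ac m).2 i : ℝ) * ((b : ℝ) ^ i * zetaValue i) =
        ∑ i ∈ OddIcc, (rhoLY v m (ac m).2 i : ℝ) * (V i : ℝ) * zetaValue i := by
      simp_rw [mul_sum]
      rw [sum_comm]
      refine sum_congr rfl fun i _ => ?_
      rw [hV]
      push_cast
      simp only [mul_sum, sum_mul]
      exact sum_congr rfl fun b _ => by ring
    rw [h2, ← sum_sdiff hTO, add_comm]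
    have h3 : ∑ i ∈ T, (rhoLY v m (ac m).2 i : ℝ) * (V i : ℝ) * zetaValue i = 0 :=
      sum_eq_zero fun i hi => by rw [hVT i hi, Int.cast_zero, mul_zero, zero_mul]
    rw [h3, zero_add]
    refine sum_congr rfl fun i hi => ?_
    rw [hq i (mem_sdiff.1 hi).1 (mem_sdiff.1 hi).2]
  -- Step 2: integrality of `A d_{vm+1}^{s+1} rtilde m`
  have hint : ∀ m : ℕ, 1 ≤ m → ∃ z : ℤ,
      (A : ℝ) * (Nat.lcmUpto (v * m + 1) : ℝ) ^ (s + 1) * rtilde m = z := by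
    intro m hm
    obtain ⟨hPF, hc, hca⟩ := hac m hm
    have hz0 : ∀ b : ℕ, ∀ j : ℕ, ∃ z : ℤ, b ∈ Ψ → j ∈ range b →
        (Nat.lcmUpto (v * m + 1) : ℚ) ^ (s + 1) * rhoZeroLY v s m (ac m).2 (thetaLY b j) = z := by
      intro b j
      by_cases h : b ∈ Ψ ∧ j ∈ range b
      · obtain ⟨z, hz⟩ := lcm_pow_mul_rhoZeroLY_isInt hm hv (hum m hm) hc (hθmem b h.1 j h.2)
        exact ⟨z, fun _ _ => hz⟩
      · exact ⟨0, fun h1 h2 => absurd ⟨h1, h2⟩ h⟩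
    choose z0 hz0 using hz0
    have hz1 : ∀ i : ℕ, ∃ z : ℤ, i ∈ OddIcc →
        (Nat.lcmUpto (v * m + 1) : ℚ) ^ (s + 1) * rhoLY v m (ac m).2 i = z := by
      intro i
      by_cases hi : i ∈ OddIcc
      · have hi3 : 3 ≤ i ∧ i ≤ s := by
          have := mem_Icc.1 (mem_filter.1 hi).1; exact ⟨this.1, this.2⟩
        obtain ⟨z, hz⟩ := lcm_pow_mul_rhoLY_isInt (u := u) (B := B) hm hv hPF hca (i := i) (by omega) hi3.2
        exact ⟨z, fun _ => hz⟩
      · exact ⟨0, fun h => absurd h hi⟩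
    choose z1 hz1 using hz1
    have hAq : ∀ i ∈ OddIcc \ T, ∃ z : ℤ, (A : ℚ) * q i = z := by
      intro i hi
      obtain ⟨k, hk⟩ : (q i).den ∣ A := dvd_prod_of_mem _ hi
      refine ⟨k * (q i).num, ?_⟩
      rw [hk]
      push_cast
      rw [mul_comm ((q i).den : ℚ), mul_assoc, mul_comm ((q i).den : ℚ) (q i), Rat.mul_den_eq_num]
    choose! zq hzq using hAq
    refine ⟨(A : ℤ) * ∑ b ∈ Ψ, w b * ∑ j ∈ range b, z0 b j +
      ∑ i ∈ OddIcc \ T, z1 i * V i * zq i, ?_⟩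
    rw [hstruct m hm]
    have e1 : ∀ b ∈ Ψ, ∀ j ∈ range b,
        (Nat.lcmUpto (v * m + 1) : ℝ) ^ (s + 1) * (rhoZeroLY v s m (ac m).2 (thetaLY b j) : ℝ) =
          (z0 b j : ℝ) := by
      intro b hb j hj
      have := hz0 b j hb hj
      exact_mod_cast congrArg (fun x : ℚ => (x : ℝ)) this
    have e2 : ∀ i ∈ OddIcc \ T,
        (A : ℝ) * (Nat.lcmUpto (v * m + 1) : ℝ) ^ (s + 1) * ((rhoLY v m (ac m).2 i : ℝ) * (V i : ℝ) * (q i : ℝ)) =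
          (z1 i : ℝ) * (V i : ℝ) * (zq i : ℝ) := by
      intro i hi
      have h1 := congrArg (fun x : ℚ => (x : ℝ)) (hz1 i (mem_sdiff.1 hi).1)
      have h2 := congrArg (fun x : ℚ => (x : ℝ)) (hzq i hi)
      push_cast at h1 h2 ⊢
      rw [← h1, ← h2]
      ring
    have eP : (A : ℝ) * (Nat.lcmUpto (v * m + 1) : ℝ) ^ (s + 1) *
        (∑ b ∈ Ψ, (w b : ℝ) * ∑ j ∈ range b, (rhoZeroLY v s m (ac m).2 (thetaLY b j) : ℝ)) =
        (((A : ℤ) * ∑ b ∈ Ψ, w b * ∑ j ∈ range b, z0 b j : ℤ) : ℝ) := by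
      push_cast
      simp only [mul_sum]
      refine sum_congr rfl fun b hb => sum_congr rfl fun j hj => ?_
      rw [← e1 b hb j hj]
      ring
    have eQ : (A : ℝ) * (Nat.lcmUpto (v * m + 1) : ℝ) ^ (s + 1) *
        (∑ i ∈ OddIcc \ T, (rhoLY v m (ac m).2 i : ℝ) * (V i : ℝ) * (q i : ℝ)) =
        ((∑ i ∈ OddIcc \ T, z1 i * V i * zq i : ℤ) : ℝ) := by
      rw [mul_sum]
      push_cast
      exact sum_congr rfl fun i hi => e2 i hi
    rw [mul_add, eP, eQ]
    push_cast
    ring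
  -- Step 3: asymptotics — `rtilde m / r_{vm,1} → ∑_b w_b b = Nw ≠ 0`
  have hrpos : ∀ m : ℕ, 1 ≤ m → 0 < rT u v s B m 1 := fun m hm =>
    rT_pos hv hm (by omega) hNs' one_pos le_rfl
  have hratio' : ∀ b ∈ Ψ, ∀ j ∈ range b,
      Tendsto (fun m : ℕ => rT u v s B m (thetaLY b j) / rT u v s B m 1) atTop (𝓝 1) := by
    intro b hb j hj
    have h := (hratio _ (hθmem b hb j hj)).inv₀ one_ne_zero
    rw [inv_one] at h
    refine h.congr fun m => ?_
    rw [inv_div]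
  have hratio : Tendsto (fun m : ℕ => rtilde m / rT u v s B m 1) atTop (𝓝 (Nw : ℝ)) := by
    have hform : ∀ m : ℕ, ∑ b ∈ Ψ, (w b : ℝ) * ∑ j ∈ range b,
        (rT u v s B m (thetaLY b j) / rT u v s B m 1) = rtilde m / rT u v s B m 1 := by
      intro m
      rw [hrtilde, sum_div]
      refine sum_congr rfl fun b _ => ?_
      rw [mul_div_assoc, sum_div]
    refine Tendsto.congr hform ?_
    rw [hNw]
    push_cast
    refine tendsto_finsetSum _ fun b hb => ?_
    have h1 : Tendsto (fun m : ℕ => ∑ j ∈ range b, rT u v s B m (thetaLY b j) / rT u v s B m 1)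
        atTop (𝓝 (∑ j ∈ range b, (1 : ℝ))) := tendsto_finsetSum _ fun j hj => hratio' b hb j hj
    rw [sum_const, card_range, nsmul_eq_mul, mul_one] at h1
    exact h1.const_mul _
  have hzlim : Tendsto (fun m : ℕ => (A : ℝ) * (Nat.lcmUpto (v * m + 1) : ℝ) ^ (s + 1) * rtilde m)
      atTop (𝓝 0) := by
    have h := (hdecay.const_mul (A : ℝ)).mul hratio
    rw [mul_zero, zero_mul] at h
    refine h.congr' ?_
    filter_upwards [eventually_ge_atTop 1] with m hm
    have := (hrpos m hm).ne'
    field_simp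
  have hne : ∀ᶠ m : ℕ in atTop, (A : ℝ) * (Nat.lcmUpto (v * m + 1) : ℝ) ^ (s + 1) * rtilde m ≠ 0 := by
    have hN0 : (Nw : ℝ) ≠ 0 := by exact_mod_cast hwN
    have h1 : ∀ᶠ m : ℕ in atTop, rtilde m / rT u v s B m 1 ≠ 0 :=
      hratio.eventually (isOpen_ne.mem_nhds hN0)
    filter_upwards [h1, eventually_ge_atTop 1] with m hm hm1
    have hA0 : (A : ℝ) ≠ 0 := by exact_mod_cast hApos.ne'
    have hd0 : (Nat.lcmUpto (v * m + 1) : ℝ) ^ (s + 1) ≠ 0 :=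
      pow_ne_zero _ (by exact_mod_cast (Nat.lcmUpto_pos _).ne')
    have hrt : rtilde m ≠ 0 := fun h0 => hm (by rw [h0, zero_div])
    exact mul_ne_zero (mul_ne_zero hA0 hd0) hrt
  -- Step 4: a non-zero integer of absolute value `< 1`
  have hsmall : ∀ᶠ m : ℕ in atTop, |(A : ℝ) * (Nat.lcmUpto (v * m + 1) : ℝ) ^ (s + 1) * rtilde m| < 1 := by
    have := (hzlim.abs).eventually (gt_mem_nhds (show |(0 : ℝ)| < 1 by simp))
    exact this
  obtain ⟨m, hm1, hm2, hm3⟩ := ((eventually_ge_atTop 1).and (hne.and hsmall)).exists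
  obtain ⟨z, hz⟩ := hint m hm1
  rw [hz] at hm2 hm3
  have hz0 : z = 0 := by
    have : |z| < 1 := by exact_mod_cast hm3
    exact Int.abs_lt_one_iff.1 this
  exact hm2 (by rw [hz0, Int.cast_zero])

end Lemma41

end Literature.NumberTheory.Irrationality.LaiYu2020
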